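import Summits.AtomisticToContinuum.BoseEinsteinCondensation.Theorems.BECHardSphereReductionHardSphereBECZeroModeDominance

/-!
# Crux `HardSphereBEC` (stmt-11885), line `registered` — for NONNEGATIVE near-minimisers the open
# kernel of `stub_infraredBound` is the MESOSCOPIC WINDOW `K₀/L < |p| ≤ √(32πη/c)` only

Route `BECHardSphereReduction`, lead c7 (2026-08-17).  Units `a = 1`, `ħ = 2m = 1`; `HS₁ = ⊤·1_{[0,1]}`;
`L = L_N(η) = (N/η)^{1/3}`; Neumann index cut-offs `K` (modes `0 < π|k| ≤ K`, momenta `|p| ≤ K/L`);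
`φ₀ = L^{-3/2}·1_{Λ_L}`; `M₀ := |𝒫_L(K₀)| = #{k ≠ 0 : π|k| ≤ K₀}` (a number depending on `K₀` only).

Two certified halves are put together:
* ultraviolet (lead c4, p147997): for a `δ`-near-minimiser (`δ ≤ 1`) of the unit-hard-sphere energy,
  `n₊ᴴ(√(32πη/c)·L) ≤ cN/4 + c/(32πη)` by the kinetic gap and Dyson's bound `E₀ ≤ 8πηN`;
* far infrared (lead c7, `ZeroModeDominance`, p159497): for a NONNEGATIVE Bose-symmetric state,
  `n₊ᴸ(K₀) ≤ 8 M₀ · ⟨φ₀,γ_Ψφ₀⟩` (the zero mode dominates every Neumann mode pointwise-in-`k`).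

Hence (`zeroMode_of_window_core_of_nonneg`, one `N` at a time, and the eventual/sparse form
`sparsePositiveZeroMode_of_windowBound`): **if the WINDOW modes `K₀ < π|k| ≤ √(32πη/c)·L` of the
nonnegative near-minimisers hold at most `(1 - 2c)N` particles** — stated without subtraction as
`n₊ᴸ(√(32πη/c)·L) + 2cN ≤ n₊ᴸ(K₀) + N` — **then their zero mode holds at least `cN/(1 + 8M₀)`.**
With `K₀ = 0` (`M₀ = 0`, `n₊ᴸ(0) = 0`) this is lead c4's `zeroMode_of_infrared_core` restricted to
nonnegative states; the point is that `K₀` is now ARBITRARY (fixed as `N → ∞`): for positive states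
nothing about the finitely many lowest box modes is open, and the physics kernel of the line — in the
positivity form used by the summit's routes `PositiveZeroMode` / `NonnegNearMinimiser` + the transfer
`positivityTransfer_proof` — is an occupation bound for the mesoscopic window alone, uniformly along
`L_N(η) → ∞`.  (For the `∀Ψ`-typed registered stub the transfer to sign-changing near-minimisers is the
fixed-`N` rigidity input of those routes; nothing here changes the registered skeleton.)
-/

noncomputable section

namespace Summit.AtomisticToContinuum.BoseEinsteinCondensation.Cruxes.HardSphereBEC

open MeasureTheory ENNReal Filter Topology Literature.MathematicalPhysics.QuantumManyBody.BoseGas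
open Literature.MathematicalPhysics.QuantumManyBody.NeumannBox
open Summit.AtomisticToContinuum.BoseEinsteinCondensation.Theorems

namespace ZeroModeDominance

variable {n : ℕ}

/-- **Core estimate at fixed `N = n+1`, nonnegative states, arbitrary far-infrared cut-off `K₀`.**
Let `η, c > 0`, `L = L_{n+1}(η)`, `K = √(32πη/c)·L`, `K₀ ∈ ℝ` (any index cut-off), `M₀ = |𝒫_L(K₀)|`.  If
`E₀(HS₁, n+1, L) ≤ 8πη(n+1)`, `n+1 ≥ 1/(24πη)`, and a NONNEGATIVE Dirichlet trial state `Ψ` with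
`⟨Ψ,HΨ⟩ ≤ E₀ + δ`, `δ ≤ 1`, satisfies the WINDOW bound `n₊ᴸ(K) + 2c(n+1) ≤ n₊ᴸ(K₀) + (n+1)`, then
`⟨φ₀, γ_Ψ φ₀⟩ ≥ c(n+1)/(1 + 8M₀)`.  Proof: `N = n₀ + n₊ᴸ(K) + n₊ᴴ(K)` (p147997),
`n₊ᴴ(K) ≤ cN/4 + c/(32πη) =: B` with `cN + B ≤ 2cN`, and `n₊ᴸ(K₀) ≤ 8M₀ n₀` (p159497).
[folklore] -/
theorem zeroMode_of_window_core_of_nonneg {η c : ℝ} (K₀ : ℝ) (hη : 0 < η) (hc : 0 < c)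
    {δ : ℝ≥0∞} (hδ : δ ≤ 1)
    (hE₀ : groundStateEnergy (Set.indicator (Set.Iic 1) (fun _ : ℝ => (⊤ : ℝ≥0∞))) (n + 1)
      (sideLength η (n + 1)) ≤ ENNReal.ofReal (8 * Real.pi * η * ((n + 1 : ℕ) : ℝ)))
    (hlarge : 1 / (24 * Real.pi * η) ≤ ((n + 1 : ℕ) : ℝ))
    (Ψ : TrialState (n + 1) (sideLength η (n + 1)))
    (hpos : ∀ X, Ψ.ψ X = (‖Ψ.ψ X‖ : ℂ))
    (hΨ : energy (Set.indicator (Set.Iic 1) (fun _ : ℝ => (⊤ : ℝ≥0∞))) Ψ ≤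
      groundStateEnergy (Set.indicator (Set.Iic 1) (fun _ : ℝ => (⊤ : ℝ≥0∞))) (n + 1)
        (sideLength η (n + 1)) + δ)
    (hWB : nPlusLow (Real.sqrt (32 * Real.pi * η / c) * sideLength η (n + 1))
        (sideLength η (n + 1)) (n + 1) Ψ.ψ + ENNReal.ofReal (2 * c * ((n + 1 : ℕ) : ℝ)) ≤
      nPlusLow K₀ (sideLength η (n + 1)) (n + 1) Ψ.ψ + ((n + 1 : ℕ) : ℝ≥0∞)) :
    ENNReal.ofReal (c * ((n + 1 : ℕ) : ℝ) / (1 + 8 * ((lowModes K₀).card : ℝ))) ≤ occupation (n + 1)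
      ((box (sideLength η (n + 1))).indicator
        fun _ => ((Real.sqrt (sideLength η (n + 1) ^ 3))⁻¹ : ℂ)) Ψ.ψ := by
  set K := Real.sqrt (32 * Real.pi * η / c) * (sideLength η (n + 1)) with hKdef
  set occ := occupation (n + 1) ((box (sideLength η (n + 1))).indicator fun _ => ((Real.sqrt ((sideLength η (n + 1)) ^ 3))⁻¹ : ℂ)) Ψ.ψ
    with hocc
  have hNpos : (0 : ℝ) < ((n + 1 : ℕ) : ℝ) := by exact_mod_cast Nat.succ_pos n
  have hL : 0 < (sideLength η (n + 1)) := Real.rpow_pos_of_pos (div_pos hNpos hη) _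
  have hπ : 0 < Real.pi := Real.pi_pos
  have hq : 0 < 32 * Real.pi * η / c := by positivity
  have hK : 0 < K := mul_pos (Real.sqrt_pos.2 hq) hL
  -- ((sideLength η (n + 1))/K)² = c/(32πη)
  have hLK : ((sideLength η (n + 1)) / K) ^ 2 = c / (32 * Real.pi * η) := by
    rw [hKdef, div_mul_eq_div_div_swap, div_self hL.ne', div_pow, one_pow, Real.sq_sqrt hq.le,
      one_div, inv_div]
  -- the three-way split and the ultraviolet bound (lead c4)
  have hsum : occ + nPlusLow K (sideLength η (n + 1)) (n + 1) Ψ.ψ + nPlusHigh K (sideLength η (n + 1)) (n + 1) Ψ.ψ = ((n + 1 : ℕ) : ℝ≥0∞) :=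
    occupation_add_nPlusLow_add_nPlusHigh hK.le hL Ψ
  have hUV : nPlusHigh K (sideLength η (n + 1)) (n + 1) Ψ.ψ ≤
      ENNReal.ofReal (c * ((n + 1 : ℕ) : ℝ) / 4 + c / (32 * Real.pi * η)) := by
    calc nPlusHigh K (sideLength η (n + 1)) (n + 1) Ψ.ψ
        ≤ ENNReal.ofReal (((sideLength η (n + 1)) / K) ^ 2) *
            energy (Set.indicator (Set.Iic 1) (fun _ : ℝ => (⊤ : ℝ≥0∞))) Ψ :=
          nPlusHigh_le_mul_energy hK hL _ Ψ
      _ ≤ ENNReal.ofReal (((sideLength η (n + 1)) / K) ^ 2) *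
            (ENNReal.ofReal (8 * Real.pi * η * ((n + 1 : ℕ) : ℝ)) + 1) := by
          gcongr
          exact hΨ.trans (add_le_add hE₀ hδ)
      _ = ENNReal.ofReal (c * ((n + 1 : ℕ) : ℝ) / 4 + c / (32 * Real.pi * η)) := by
          rw [hLK, ← ENNReal.ofReal_one, ← ENNReal.ofReal_add (by positivity) zero_le_one,
            ← ENNReal.ofReal_mul (by positivity)]
          congr 1
          field_simp
          ring
  set B := ENNReal.ofReal (c * ((n + 1 : ℕ) : ℝ) / 4 + c / (32 * Real.pi * η)) with hBdef
  have hB : B ≠ ⊤ := ENNReal.ofReal_ne_top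
  -- the arithmetic `cN + B ≤ 2cN` for `N ≥ 1/(24πη)`
  have hCB : ENNReal.ofReal (c * ((n + 1 : ℕ) : ℝ)) + B ≤
      ENNReal.ofReal (2 * c * ((n + 1 : ℕ) : ℝ)) := by
    rw [hBdef, ← ENNReal.ofReal_add (by positivity) (by positivity)]
    refine ENNReal.ofReal_le_ofReal ?_
    have h2 : 1 ≤ 24 * Real.pi * η * ((n + 1 : ℕ) : ℝ) := by
      rwa [div_le_iff₀' (by positivity)] at hlarge
    have h1 : c / (32 * Real.pi * η) ≤ 3 / 4 * (c * ((n + 1 : ℕ) : ℝ)) := by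
      rw [div_le_iff₀ (by positivity)]
      nlinarith [mul_le_mul_of_nonneg_left h2 hc.le]
    nlinarith
  -- the far-infrared bound (lead c7): `n₊ᴸ(K₀) ≤ 8 M₀ occ`
  have hFIR : nPlusLow K₀ (sideLength η (n + 1)) (n + 1) Ψ.ψ ≤ 8 * (lowModes K₀).card * occ := by
    rw [hocc, occupation_boxMode_eq_condensateOccupation]
    exact nPlusLow_le_of_nonneg K₀ hL Ψ.contDiff.continuous Ψ.symm hpos
  -- finiteness of the pieces
  have hN : ((n + 1 : ℕ) : ℝ≥0∞) ≠ ⊤ := ENNReal.natCast_ne_top (n + 1)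
  have hlowK : nPlusLow K (sideLength η (n + 1)) (n + 1) Ψ.ψ ≠ ⊤ := ne_top_of_le_ne_top hN
    (by rw [← hsum]; exact (le_add_left le_rfl).trans (le_add_right le_rfl))
  -- `n₊ᴸ(K) + 2cN ≤ n₊ᴸ(K₀) + N ≤ 8M₀ occ + occ + n₊ᴸ(K) + B`
  have h1 : nPlusLow K (sideLength η (n + 1)) (n + 1) Ψ.ψ + ENNReal.ofReal (2 * c * ((n + 1 : ℕ) : ℝ)) ≤
      nPlusLow K (sideLength η (n + 1)) (n + 1) Ψ.ψ + ((1 + 8 * (lowModes K₀).card) * occ + B) := by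
    calc nPlusLow K (sideLength η (n + 1)) (n + 1) Ψ.ψ + ENNReal.ofReal (2 * c * ((n + 1 : ℕ) : ℝ))
        ≤ nPlusLow K₀ (sideLength η (n + 1)) (n + 1) Ψ.ψ + ((n + 1 : ℕ) : ℝ≥0∞) := hWB
      _ ≤ 8 * (lowModes K₀).card * occ +
            (occ + nPlusLow K (sideLength η (n + 1)) (n + 1) Ψ.ψ + nPlusHigh K (sideLength η (n + 1)) (n + 1) Ψ.ψ) := by
          rw [hsum]; exact add_le_add hFIR le_rfl
      _ ≤ 8 * (lowModes K₀).card * occ + (occ + nPlusLow K (sideLength η (n + 1)) (n + 1) Ψ.ψ + B) := by gcongr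
      _ = nPlusLow K (sideLength η (n + 1)) (n + 1) Ψ.ψ + ((1 + 8 * (lowModes K₀).card) * occ + B) := by ring
  have h2 : ENNReal.ofReal (2 * c * ((n + 1 : ℕ) : ℝ)) ≤ (1 + 8 * (lowModes K₀).card) * occ + B :=
    (ENNReal.add_le_add_iff_left hlowK).1 h1
  -- combine with `cN + B ≤ 2cN` and cancel `B`
  have h3 : ENNReal.ofReal (c * ((n + 1 : ℕ) : ℝ)) + B ≤ (1 + 8 * (lowModes K₀).card) * occ + B :=
    hCB.trans h2
  have h4 : ENNReal.ofReal (c * ((n + 1 : ℕ) : ℝ)) ≤ (1 + 8 * (lowModes K₀).card) * occ :=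
    (ENNReal.add_le_add_iff_right hB).1 h3
  -- divide by `1 + 8M₀`
  have hM : (0 : ℝ) < 1 + 8 * ((lowModes K₀).card : ℝ) := by positivity
  have hMe : ((1 : ℝ≥0∞) + 8 * (lowModes K₀).card) =
      ENNReal.ofReal (1 + 8 * ((lowModes K₀).card : ℝ)) := by
    rw [ENNReal.ofReal_add zero_le_one (by positivity), ENNReal.ofReal_one,
      ENNReal.ofReal_mul (by norm_num), ENNReal.ofReal_ofNat, ENNReal.ofReal_natCast]
  rw [ENNReal.ofReal_div_of_pos hM]
  refine ENNReal.div_le_of_le_mul' ?_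
  rwa [← hMe]

/-- **Sparse positive zero-mode condensation from a sparse WINDOW bound** (eventual form, the
positivity/mesoscopic reduction of the line's kernel).  Suppose that for every threshold `η₀ > 0`
there are `η ∈ (0, η₀]`, `c > 0` and a far-infrared index cut-off `K₀` such that, eventually in `N` and
for some slack `δ > 0`, every NONNEGATIVE `δ`-near-minimiser `Ψ` of the unit-hard-sphere Dirichlet
energy in the box `L_N(η)` satisfies the window bound
`n₊ᴸ(√(32πη/c)·L_N(η)) + 2cN ≤ n₊ᴸ(K₀) + N` (the Neumann modes with `K₀ < π|k| ≤ √(32πη/c)·L_N(η)`,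
i.e. momenta `K₀/L < |p| ≤ √(32πη/c)`, hold at most `(1-2c)N` particles).  Then, for every
threshold, some `η ∈ (0, η₀]` and `c' > 0` (`c' = c/(1+8|𝒫_L(K₀)|)`) have, eventually in `N` and for
some slack, `⟨φ₀, γ_Ψ φ₀⟩ ≥ c'N` for every nonnegative near-minimiser — zero-mode condensation of the
positive near-ground states at sparse densities (the hard-sphere, sparse instance of the summit's
`PositiveZeroMode`).  Dyson's bound supplies `E₀ ≤ 8πηN` below `η₁`. [folklore] -/
theorem sparsePositiveZeroMode_of_windowBound
    (hWB : ∀ η₀ : ℝ, 0 < η₀ → ∃ η : ℝ, 0 < η ∧ η ≤ η₀ ∧ ∃ c : ℝ, 0 < c ∧ ∃ K₀ : ℝ,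
      ∀ᶠ N : ℕ in atTop, ∃ δ : ℝ≥0∞, 0 < δ ∧ ∀ Ψ : TrialState N (sideLength η N),
        energy (Set.indicator (Set.Iic 1) (fun _ : ℝ => (⊤ : ℝ≥0∞))) Ψ ≤
          groundStateEnergy (Set.indicator (Set.Iic 1) (fun _ : ℝ => (⊤ : ℝ≥0∞))) N
            (sideLength η N) + δ →
        (∀ X, Ψ.ψ X = (‖Ψ.ψ X‖ : ℂ)) →
        nPlusLow (Real.sqrt (32 * Real.pi * η / c) * sideLength η N) (sideLength η N) N Ψ.ψ +
            ENNReal.ofReal (2 * c * N) ≤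
          nPlusLow K₀ (sideLength η N) N Ψ.ψ + (N : ℝ≥0∞)) :
    ∀ η₀ : ℝ, 0 < η₀ → ∃ η : ℝ, 0 < η ∧ η ≤ η₀ ∧ ∃ c : ℝ, 0 < c ∧ ∀ᶠ N : ℕ in Filter.atTop,
      ∃ δ : ENNReal, 0 < δ ∧ ∀ Ψ : TrialState N (sideLength η N),
        energy (Set.indicator (Set.Iic 1) (fun _ : ℝ => (⊤ : ENNReal))) Ψ ≤
          groundStateEnergy (Set.indicator (Set.Iic 1) (fun _ : ℝ => (⊤ : ENNReal))) N
            (sideLength η N) + δ →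
        (∀ X, Ψ.ψ X = (‖Ψ.ψ X‖ : ℂ)) →
        ENNReal.ofReal (c * N) ≤ occupation N ((box (sideLength η N)).indicator
          fun _ => ((Real.sqrt (sideLength η N ^ 3))⁻¹ : ℂ)) Ψ.ψ := by
  obtain ⟨η₁, hη₁, hD⟩ := eventually_groundStateEnergy_hardSphere_le_eight_pi
  intro η₀ hη₀
  obtain ⟨η, hη, hηle, c, hc, K₀, hev⟩ := hWB (min η₀ (η₁ / 2)) (lt_min hη₀ (half_pos hη₁))
  refine ⟨η, hη, hηle.trans (min_le_left _ _), c / (1 + 8 * ((lowModes K₀).card : ℝ)),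
    by positivity, ?_⟩
  have hηlt : η < η₁ := (hηle.trans (min_le_right _ _)).trans_lt (half_lt_self hη₁)
  have hlarge : ∀ᶠ N : ℕ in atTop, 1 / (24 * Real.pi * η) ≤ (N : ℝ) :=
    tendsto_natCast_atTop_atTop.eventually_ge_atTop _
  filter_upwards [hev, hD η hη hηlt, hlarge, eventually_gt_atTop 0] with N hN hE₀ hNl hN0
  obtain ⟨δ, hδ, hΨ⟩ := hN
  cases N with
  | zero => exact absurd hN0 (lt_irrefl 0)
  | succ n =>
    refine ⟨min δ 1, lt_min hδ one_pos, fun Ψ hΨE hpos => ?_⟩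
    have h := zeroMode_of_window_core_of_nonneg K₀ hη hc (min_le_right _ _) hE₀ hNl Ψ hpos hΨE
      (hΨ Ψ (hΨE.trans (add_le_add le_rfl (min_le_left _ _))) hpos)
    rwa [mul_div_right_comm] at h

end ZeroModeDominance

end Summit.AtomisticToContinuum.BoseEinsteinCondensation.Cruxes.HardSphereBEC

end
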